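import Summits.CriticalPhenomena.CardyFormulaZ2.Theorems.CardyIKTransportCornerLineDescentOfCornerIrrelevanceTame

/-!
# Strategist sketch (NOT filed): the typed split of the crux `CardyIKTransport.CornerLineDescent`
# (stmt-CriticalPhenomena-10964) at the unique FKG point `t = 1` (`p = ½`, the centred-square / random-diagonal
# site model `G_s`) of the corner-fugacity line

Census artefact of `STRATEGY-CENSUS.md` §Decomposition (crux-strategist wall-breaker seat, 2026-08-17).
Vocabulary of `Theorems/CardyIKTransportCornerLineDescentLine.lean`: `gaugeCrossingProb p R δ` is the crude crossing
probability of the corner-line gauge with syndrome density `p` (`p = pIK`: isotropic Izergin–Korepin point,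
`p = ½`: i.i.d. fair cells + fair saddle coins = site percolation on `G_s` up to `CentreDiagonalEquivalence`,
`p = 0`: renewal-grid bond-ℤ²); `bondStdCrossingProb` the crude standard bond-ℤ² family; "tame" inline as in
`…OfTameStubs.lean`.

* `UpperTiltIrrelevanceTame`  — Sub₁: at tame rectangles the IK gauge (`p = pIK`, a colour-even 4-body tilt of the
  FKG point with `ρ = 7 − 4√3 ≈ 0.072`) and the FKG point `p = ½` have crude crossing probabilities differing by `o(1)`.
* `GsBondBridgeTame`          — Sub₂: at tame rectangles the FKG point `p = ½` (`G_s`-site) and crude standard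
  bond-ℤ² have crossing probabilities differing by `o(1)` (Beffara 2008 §5.2 territory; cf. UnionJackBeffara's
  `MixedInterpolation`, stmt-CriticalPhenomena-4559).
* `cornerLineDescent_of_splitAtGs : UpperTiltIrrelevanceTame → GsBondBridgeTame → CornerLineDescent` — sorry-free glue
  (the crux's hypothesis `CardyIK` transfers along the two vanishing differences; tame ⇒ all `R` by the landed
  `crudeBondCardy_of_tame`, p126699).

Why it is NOT filed as `route edit --split` by this seat: see the census — both children inherit the same wall
(quantitative isotropisation of the four-arm sector beyond the marginal rate `2 − x₄ = 3/4`), Sub₂ re-files another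
route's open XL crux in this route, and under `CardyIK` the conjunction is `crux ∧ Cardy(G_s)`.  The file is attached so
that a human ruling "split at G_s" costs one `ledger propose` and one `route edit`.
-/

noncomputable section

namespace Summit.CriticalPhenomena.CardyFormulaZ2.Cruxes.CornerLineDescent.SplitAtGs

open scoped Topology
open Filter Set
open Literature.Probability.RandomPlanarGeometry
open Summit.CriticalPhenomena.CardyFormulaZ2.Theorems.CornerLineDescent.SymmetricSeed

/-- Sub₁ (would-be sub-crux, rank 2): UPPER-TILT IRRELEVANCE AT TAME RECTANGLES — the isotropic IK gauge and the
i.i.d. point `p = ½` have asymptotically equal crude crossing probabilities in every tame conformal rectangle.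
Content: one-lattice universality across the colour-even plaquette tilt `∏_f (1 + ρ κ_f)`, `ρ = 7 − 4√3`, of the
FKG critical site model `G_s`; every probabilistic estimate of its natural line (all-orders seed expansion AT `p = ½`)
lives in an FKG model with RSW, but its first-order term already needs the four-arm isotropisation rate `> 3/4`. -/
def UpperTiltIrrelevanceTame : Prop :=
  ∀ R : ConformalRectangle,
    (∃ G : ℂ → ℂ, ∃ r : ℝ, 1 < r ∧ DifferentiableOn ℂ G (Metric.ball 0 r) ∧ Set.InjOn G (Metric.ball 0 r) ∧
      R.carrier = G '' Metric.ball 0 1) →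
    Tendsto (fun δ => gaugeCrossingProb pIK R δ - gaugeCrossingProb (1 / 2) R δ) (𝓝[>] 0) (𝓝 0)

/-- Sub₂ (would-be sub-crux, rank 3): `G_s`-TO-BOND BRIDGE AT TAME RECTANGLES — the i.i.d. point `p = ½` (site
percolation on the centred square lattice `G_s`, up to `CentreDiagonalEquivalence`) and crude standard bond-ℤ² at `½`
have asymptotically equal crossing probabilities in every tame conformal rectangle.  Beffara's mixed-percolation
interpolation `P_{1/2,q}` (arXiv:0708.3908 §5.2) is the FKG product highway between the two; its residue is the
catalogued `Literature.Barriers.CriticalPhenomena.CoveringLatticeShift`. -/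
def GsBondBridgeTame : Prop :=
  ∀ R : ConformalRectangle,
    (∃ G : ℂ → ℂ, ∃ r : ℝ, 1 < r ∧ DifferentiableOn ℂ G (Metric.ball 0 r) ∧ Set.InjOn G (Metric.ball 0 r) ∧
      R.carrier = G '' Metric.ball 0 1) →
    Tendsto (fun δ => gaugeCrossingProb (1 / 2) R δ - bondStdCrossingProb R δ) (𝓝[>] 0) (𝓝 0)

/-- GLUE (sorry-free): the split at `G_s` implies the crux.  Given the crux's hypothesis (Cardy for `P_IK`, all `R`),
Cardy passes to `p = ½` and then to crude standard bond-ℤ² along the two vanishing differences at every tame `R`, and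
`crudeBondCardy_of_tame` (unconditional, p126699) removes tameness. -/
theorem cornerLineDescent_of_splitAtGs (h₁ : UpperTiltIrrelevanceTame) (h₂ : GsBondBridgeTame) :
    Summit.CriticalPhenomena.CardyFormulaZ2.Theses.CardyIKTransport.CornerLineDescent := by
  rw [cornerLineDescent_iff]
  intro hIK
  refine crudeBondCardy_of_tame fun R hR => ?_
  intro φ x hφx
  have h3 := ((hIK R φ x hφx).sub (h₁ R hR)).sub (h₂ R hR)
  simp only [sub_sub_cancel, sub_zero] at h3
  exact h3

/-- Converse bookkeeping (why the split is not a free lunch): under the crux's hypothesis `CardyIK` and Cardy for the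
FKG point `p = ½` at tame rectangles, the crux gives back BOTH children — i.e. granted `CardyIK`,
`Sub₁ ∧ Sub₂ ↔ crux ∧ (tame Cardy for G_s)`; the surplus conjunct is UnionJackBeffara's target conjunct
`UnionJackCardy` in the cell gauge. Only the easy direction needed for that remark is recorded here. -/
theorem splitAtGs_of_cornerLineDescent_of_cardyGs
    (hIK : ∀ R : ConformalRectangle, R.HasCrossingLimit (gaugeCrossingProb pIK R) cardyFunction)
    (hGs : ∀ R : ConformalRectangle,
      (∃ G : ℂ → ℂ, ∃ r : ℝ, 1 < r ∧ DifferentiableOn ℂ G (Metric.ball 0 r) ∧ Set.InjOn G (Metric.ball 0 r) ∧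
        R.carrier = G '' Metric.ball 0 1) →
      R.HasCrossingLimit (gaugeCrossingProb (1 / 2) R) cardyFunction)
    (h : Summit.CriticalPhenomena.CardyFormulaZ2.Theses.CardyIKTransport.CornerLineDescent) :
    UpperTiltIrrelevanceTame ∧ GsBondBridgeTame := by
  rw [cornerLineDescent_iff] at h
  have hB := h hIK
  refine ⟨fun R hR => ?_, fun R hR => ?_⟩
  · obtain ⟨φ, x, hφx⟩ := MarkedDomain.exists_isUniformizing_holds R
    have := (hIK R φ x hφx).sub (hGs R hR φ x hφx)
    simpa using this
  · obtain ⟨φ, x, hφx⟩ := MarkedDomain.exists_isUniformizing_holds R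
    have := (hGs R hR φ x hφx).sub (hB R φ x hφx)
    simpa using this

end Summit.CriticalPhenomena.CardyFormulaZ2.Cruxes.CornerLineDescent.SplitAtGs
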